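import Literature.AlgebraicGeometry.Surfaces.K3TwoZeroLine

/-!
# The coefficient of a holomorphic `2`-form against a holomorphic `2`-form that does not vanish on an OPEN SET of a complex surface
# (programme PG-FERMAT, brick F1a — local form of the tree's `TwoForms.exists_apply_eq_smul` / `differentiableAt_coeff`)

Prover seat `hodge-nonav-prover-Bx` (g10), cell `hodge-nonav`, for crux K1-A (stmt-HodgeConjecture-19544) of route `HodgeConjecture/CyclicUnitaryPowers`:
programme PG-FERMAT (memo `PROGRAMME-PG-FERMAT-Bx-g10.md`) needs, on the Hodge model `M` of the Fermat surface, to write a holomorphic `2`-form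
`β` as `g · η₃` on the open piece `U₃ = {x₃ ≠ 0}` where the residue frame `η₃ = Res(x₃^{p−4}Ω/F)` does not vanish, with `g` holomorphic there
(brick F1a). The tree's `Literature/AlgebraicGeometry/Surfaces/K3TwoZeroLine` proves exactly this for a `2`-form `η` that vanishes NOWHERE on
`M` (the K3 case, `Ω² ≅ 𝒪`); this file records the LOCAL versions, with the same proofs (C. Voisin, *Hodge Theory I*, §2.3.1 and the proof of
Cor. 7.6: a closed `(2,0)`-form is holomorphic; pointwise `Λ²_ℂ T*_x = ℂ η_x`):

* `exists_apply_eq_smul_of_ne_zero` — at a point where the holomorphic `2`-form `η` is non-zero, every `(2,0)`-form `β` is `β x = t • η x`.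
* `differentiableAt_coeff_of_isOpen` — if `β = f • η` on an open `O` on which `η` does not vanish (`β` smooth and closed), then `f` is
  complex-differentiable in the chart at every `x ∈ O`.
* **`exists_coeff_of_holForm`** — for `ω, η ∈ Ω²(M)` holomorphic in charts and `O` open with `η ≠ 0` on `O`: there is `f : M → ℂ` with
  `ω x = f x • η x` on `O` and `f ∘ (chart at x)⁻¹` complex-differentiable at the chart centre for every `x ∈ O`.

Sorry-free; no definition, no named fact; helper; nothing here says HC ∕ HC_AV is proved.
-/

noncomputable section

set_option linter.dupNamespace false

open scoped Manifold ContDiff Topology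
open Complex

namespace Summit.HodgeConjecture.HodgeConjecture.Theorems.CyclicUnitaryPowersTopFormRatio

open Literature.Geometry.Kaehler Literature.NumberTheory.Transcendental Filter Set
open Literature.AlgebraicGeometry.Surfaces.TwoForms

variable {E : Type*} [NormedAddCommGroup E] [NormedSpace ℂ E] [FiniteDimensional ℂ E]
  {M : Type*} [TopologicalSpace M] [ChartedSpace E M] [IsManifold 𝓘(ℝ, E) ∞ M]

omit [FiniteDimensional ℂ E] in
/-- **Pointwise, at a point where the holomorphic `2`-form `η` does not vanish, a `(2,0)`-form is a multiple of it**: `β x = t • η x`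
(`β x` is `ℂ`-bilinear by weight, `Λ²_ℂ T^*_x = ℂ η_x` as `dim_ℂ E = 2`). Local form of `TwoForms.exists_apply_eq_smul`.
[cite: VoisinHodgeI2002, §2.3.1] -/
theorem exists_apply_eq_smul_of_ne_zero (h2 : Module.finrank ℂ E = 2) {η β : MForm 𝓘(ℝ, E) M ℂ 2}
    (hη : IsHolomorphicInCharts η) {x : M} (hηx : η x ≠ 0) (hβ : IsOfType 2 0 β) :
    ∃ t : ℂ, β x = t • η x := by
  obtain ⟨a, ha⟩ := hη.exists_apply_eq_restrictScalars x
  have ha0 : a ≠ 0 := by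
    intro h0
    apply hηx
    rw [ha, h0]
    ext v
    rfl
  have hw : ∀ (θ : ℝ) (v : Fin 2 → E),
      β x (fun i ↦ Complex.exp (θ * I) • v i) = Complex.exp (2 * θ * I) * β x v := by
    intro θ v
    have h := hβ.2 x θ v
    have hrot : (fun i ↦ tangentRotate E x θ (v i)) = fun i ↦ Complex.exp (θ * I) • v i := rfl
    rw [hrot] at h
    norm_num at h
    exact h
  obtain ⟨t, ht⟩ := exists_eq_mul_of_complexHomogeneous h2 a ha0 (β x)
    (map_vec2_complex_smul_left _ hw) (map_vec2_complex_smul_right _ hw)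
  refine ⟨t, ContinuousAlternatingMap.ext fun u ↦ ?_⟩
  rw [ContinuousAlternatingMap.smul_apply, smul_eq_mul]
  refine (ht u).trans ?_
  rw [ha]
  rfl

/-- **The coefficient of a closed `(2,0)`-form against a holomorphic `2`-form non-vanishing on an open set is holomorphic there** (chart at
the point): if `β y = f y • η y` for `y` in the open `O`, `η y ≠ 0` on `O`, `β` smooth and closed, `η` holomorphic in charts, then for
`x ∈ O`, `f ∘ (chart at x)⁻¹` is complex-differentiable at the chart centre — `0 = dβ = dF ∧ G` forces `dF` to be `ℂ`-linear. Local form of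
`TwoForms.differentiableAt_coeff` (same proof). [cite: VoisinHodgeI2002, §2.3.1 and Cor. 7.6 (proof)] -/
theorem differentiableAt_coeff_of_isOpen (h2 : Module.finrank ℂ E = 2) {η β : MForm 𝓘(ℝ, E) M ℂ 2}
    (hη : IsHolomorphicInCharts η) {O : Set M} (hO : IsOpen O) (hη0 : ∀ y ∈ O, η y ≠ 0)
    (hβs : IsSmoothForm β) (hβc : IsClosedForm β)
    {f : M → ℂ} (hf : ∀ y ∈ O, β y = f y • η y) {x : M} (hx : x ∈ O) :
    DifferentiableAt ℂ (f ∘ (extChartAt 𝓘(ℝ, E) x).symm) (extChartAt 𝓘(ℝ, E) x x) := by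
  set c := extChartAt 𝓘(ℝ, E) x x with hc
  set F : E → ℂ := f ∘ (extChartAt 𝓘(ℝ, E) x).symm with hF
  obtain ⟨g, hg, hηg⟩ := hη x
  set G : E → E [⋀^Fin 2]→L[ℝ] ℂ := fun y ↦ (g y).restrictScalars ℝ with hG
  -- (0) near the centre the inverse chart lands in `O`
  have hOc : ∀ᶠ y in 𝓝 c, (extChartAt 𝓘(ℝ, E) x).symm y ∈ O := by
    have hcont : ContinuousAt (extChartAt 𝓘(ℝ, E) x).symm c := continuousAt_extChartAt_symm x
    refine hcont.preimage_mem_nhds ?_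
    rw [hc, extChartAt_to_inv]
    exact hO.mem_nhds hx
  -- (1) `β = F • η` in the chart near the centre, hence `β = F • G` near the centre
  have hβF : ∀ᶠ y in 𝓝 c, β.inChart x y = F y • η.inChart x y := by
    filter_upwards [hOc] with y hy
    simp only [MForm.inChart, hf _ hy, hF, Function.comp_apply]
    ext v
    rfl
  have hβFG : β.inChart x =ᶠ[𝓝 c] fun y ↦ F y • G y := by
    filter_upwards [hηg, hβF] with y hy hy'
    rw [hy', hy]
  -- (2) the germ `g` does not vanish at the centre
  have hGc : G c = η x := by
    rw [← MForm.inChart_apply_self η x]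
    exact (hηg.eq_of_nhds).symm
  have hgc : g c ≠ 0 := by
    intro h0
    apply hη0 x hx
    rw [← hGc, hG]
    ext v
    simp only [h0]
    rfl
  -- (3) differentiability of `G`, `β.inChart x` and of the coefficient `F` at the centre
  set R : (E [⋀^Fin 2]→L[ℂ] ℂ) →L[ℝ] (E [⋀^Fin 2]→L[ℝ] ℂ) :=
    ContinuousAlternatingMap.restrictScalarsCLM (𝕜 := ℂ) (E := E) (F := ℂ) (ι := Fin 2) ℝ
    with hRdef
  have hGD : HasFDerivAt G (R.comp ((fderiv ℂ g c).restrictScalars ℝ)) c :=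
    R.hasFDerivAt.comp c (hg.differentiableAt.hasFDerivAt.restrictScalars ℝ)
  have hGd : DifferentiableAt ℝ G c := hGD.differentiableAt
  have hβd : DifferentiableAt ℝ (β.inChart x) c := by
    have h := hβs x
    rw [ModelWithCorners.Boundaryless.range_eq_univ, contDiffWithinAt_univ] at h
    exact h.differentiableAt (by simp)
  obtain ⟨w, hw⟩ : ∃ w : Fin 2 → E, g c w ≠ 0 := by
    refine not_forall.1 fun hall ↦ hgc (ContinuousAlternatingMap.ext fun w ↦ ?_)
    rw [hall w, ContinuousAlternatingMap.coe_zero, Pi.zero_apply]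
  have hGw : G c w ≠ 0 := by simpa [hG] using hw
  have hFq : F =ᶠ[𝓝 c] fun y ↦ β.inChart x y w * (G y w)⁻¹ := by
    have hne : ∀ᶠ y in 𝓝 c, G y w ≠ 0 :=
      (hGd.continuousAlternatingMap_apply_const w).continuousAt.eventually_ne hGw
    filter_upwards [hβFG, hne] with y hy hy0
    rw [hy, ContinuousAlternatingMap.smul_apply, smul_eq_mul, mul_inv_cancel_right₀ hy0]
  have hFd : DifferentiableAt ℝ F c := by
    have h1 : DifferentiableAt ℝ (fun y ↦ β.inChart x y w) c :=
      hβd.continuousAlternatingMap_apply_const w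
    have h2' : DifferentiableAt ℝ (fun y ↦ G y w) c := hGd.continuousAlternatingMap_apply_const w
    have h3 : DifferentiableAt ℝ (fun y ↦ β.inChart x y w * (G y w)⁻¹) c :=
      h1.fun_mul (h2'.fun_inv hGw)
    exact hFq.differentiableAt_iff.2 h3
  -- (4) the exterior derivatives at the centre: `dβ = 0`, `dG = 0`, product rule
  have hd0 : extDeriv (β.inChart x) c = 0 := by
    have h := congrFun hβc x
    rw [mextDeriv_eq_extDerivWithin, ModelWithCorners.Boundaryless.range_eq_univ,
      extDerivWithin_univ] at h
    exact h
  have hdG : extDeriv G c = 0 := by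
    rw [← hηg.extDeriv_eq]
    exact hη.extDeriv_inChart_eq_zero h2 x
  have hD : HasFDerivAt (fun y ↦ F y • G y)
      (F c • fderiv ℝ G c + (fderiv ℝ F c).smulRight (G c)) c :=
    hFd.hasFDerivAt.smul hGd.hasFDerivAt
  have hkey : ContinuousAlternatingMap.alternatizeUncurryFin
      ((fderiv ℝ F c).smulRight ((g c).restrictScalars ℝ)) = 0 := by
    have h := hβFG.extDeriv_eq
    rw [hd0, extDeriv, hD.fderiv, ContinuousAlternatingMap.alternatizeUncurryFin_add,
      ContinuousAlternatingMap.alternatizeUncurryFin_smul] at h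
    have h' : ContinuousAlternatingMap.alternatizeUncurryFin (fderiv ℝ G c) = 0 := hdG
    rw [h', smul_zero, zero_add] at h
    exact h.symm
  -- (5) `dF(c)` is `ℂ`-linear, so `F` is complex-differentiable at `c`
  obtain ⟨Lc, hLc⟩ := exists_restrictScalars_eq _
    (complexLinear_of_alternatizeUncurryFin_eq_zero h2 (g c) hgc _ hkey)
  exact (differentiableAt_iff_restrictScalars ℝ hFd).2 ⟨Lc, hLc⟩

/-- **Brick F1a.** For holomorphic `2`-forms `β`, `η` (in charts) on a complex surface and an open `O` on which `η` does not vanish, there is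
a coefficient `f : M → ℂ` with `β = f • η` on `O`, complex-differentiable in the chart at every point of `O` (`β` has type `(2,0)`, is
smooth and closed: `IsHolomorphicInCharts.isOfType/isSmoothForm/isClosedForm`; pointwise division `exists_apply_eq_smul_of_ne_zero`;
holomorphy `differentiableAt_coeff_of_isOpen`). Off `O` we set `f = 0`. [cite: VoisinHodgeI2002, §2.3.1 and Cor. 7.6 (proof)] -/
theorem exists_coeff_of_holForm (h2 : Module.finrank ℂ E = 2) {η β : MForm 𝓘(ℝ, E) M ℂ 2}
    (hη : IsHolomorphicInCharts η) (hβh : IsHolomorphicInCharts β) {O : Set M} (hO : IsOpen O) (hη0 : ∀ y ∈ O, η y ≠ 0) :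
    ∃ f : M → ℂ, (∀ y ∈ O, β y = f y • η y) ∧ (∀ y ∉ O, f y = 0) ∧
      ∀ x ∈ O, DifferentiableAt ℂ (f ∘ (extChartAt 𝓘(ℝ, E) x).symm) (extChartAt 𝓘(ℝ, E) x x) := by
  classical
  have hβt : IsOfType 2 0 β := hβh.isOfType
  have ht : ∀ y : M, y ∈ O → ∃ t : ℂ, β y = t • η y := fun y hy ↦
    exists_apply_eq_smul_of_ne_zero h2 hη (hη0 y hy) hβt
  choose! t ht using ht
  refine ⟨fun y ↦ if y ∈ O then t y else 0, fun y hy ↦ by simp only [hy, if_true]; exact ht y hy,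
    fun y hy ↦ by simp only [hy, if_false], fun x hx ↦ ?_⟩
  have hβs : IsSmoothForm β := hβh.isSmoothForm
  have hβc : IsClosedForm β := hβh.isClosedForm h2
  exact differentiableAt_coeff_of_isOpen h2 hη hO hη0 hβs hβc
    (f := fun y ↦ if y ∈ O then t y else 0) (fun y hy ↦ by simp only [hy, if_true]; exact ht y hy) hx

end Summit.HodgeConjecture.HodgeConjecture.Theorems.CyclicUnitaryPowersTopFormRatio

end
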